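import Summits.CriticalPhenomena.PercolationContinuityZ3.Theorems.Transplant.CayleyMilnorWords
import Summits.CriticalPhenomena.PercolationContinuityZ3.Theorems.Transplant.PlanarSkeletonFrmScaledBoxProd
import HarnessLib

/-!
# Milnor's kernel lemma, II: off exponential growth the kernel of EVERY homomorphism `Γ → ℤ²` is finitely generated — so
# INPUT(Cay(Γ; S)) = "a homomorphism `Γ → ℤ²` of rank-2 image" (`b₁(Γ) ≥ 2`), NOTHING ELSE, modulo the one-type scaled node

builds on p205010 (kernel theorem, internal audit signed; external expert review pending) — nothing in this file uses p205010.  The two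
percolation theorems at the end are CONDITIONAL on the OPEN node `SamePDropOfSkeletonFrmScaled₁` (hypothesis `hN`; nothing is claimed about
it) and on NOTHING ELSE.  Lane `prim-bschramm`, seat `prim-bschramm-p4` gen 17 (PART C3 of `P4-GENERAL.md` §39).  Helper file
(`--supports stmt-CriticalPhenomena-4575`).

WHAT THIS FILE REMOVES.  Gen 16's class of record (`CayleyScaled.criticalContinuity_of_kerFG`, file `CayleyScaledExtensions`) asked for a
homomorphism `φ : Γ → ℤ²` of rank-2 image AND a finitely generated kernel.  The kernel hypothesis is automatic exactly where it is needed: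
* **MILNOR'S KERNEL LEMMA** [Milnor 1968, Lemma 1; Rosset 1976, Thm. 1 for the general statement]: if `Γ = ⟨S⟩` and `Cay(Γ; S)` does NOT
  have exponential growth, then for every homomorphism `ψ : Γ → ℤ` and every finitely generated `H = ⟨T⟩ ≤ Γ` the subgroup `H ∩ ker ψ` is
  finitely generated (`Milnor.exists_finset_closure_inf_ker`: pick `t ∈ H` with `ψ(t)` generating `ψ(H)`; write each `s ∈ T` as
  `a_s t^{k_s}` with `a_s ∈ ker ψ`; then `H ∩ ker ψ` is generated by the conjugates `t^k a_s t^{-k}` (`ker_inf_closure_eq`, a normal-closure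
  computation), and by file I each family `{t^k a_s t^{-k}}_k` lies in the span of finitely many of its members); applied twice,
  **`Milnor.ker_fg_of_not_hasExponentialGrowth`: the kernel of every `φ : Γ →* Multiplicative (Site 2)` is finitely generated**;
* ON exponential growth Hutchcroft's theorem (tree theorem `Hutchcroft2016_noPercolationAtCriticality_holds`) gives `θ(p_c) = 0` outright.
Hence **`CayleyScaled.criticalContinuity_of_rank (hN) (φ) (hrank) (S) (hS) (g) : θ_g(p_c(Cay(Γ; S))) = 0`** — EVERY finitely generated group
with a homomorphism to `ℤ²` of rank-2 image (equivalently: first Betti number `b₁(Γ) ≥ 2`), EVERY finite generating set, modulo the scaled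
node ALONE.  What this does not reach among Cayley graphs is exactly `b₁(Γ) ≤ 1` (P4-GENERAL §39: virtually-`b₁ ≥ 2` groups with `b₁ ≤ 1` =
the multi-type wall; torsion groups of intermediate growth = no chart on any finite-index subgroup).
[cite: MilnorSolvableGrowth1968, Lemma 1 pp. 447–448] [cite: Rosset1976, Thm. 1] [cite: Hutchcroft2016, Thm. 1.1]
[cite: BenjaminiSchramm1996, Conj. 4; §2 (Cayley graphs)]
-/

noncomputable section

namespace Summit.CriticalPhenomena.PercolationContinuityZ3.Theorems.Transplant

open SimpleGraph Filter Literature.Barriers.CriticalPhenomena Literature.Probability.LatticeModels Literature.Probability.Percolation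
open scoped Classical

namespace Milnor

variable {Γ : Type} [Group Γ]

/-! ## §1 The normal-closure computation: `⟨T⟩ ∩ ker ψ = ⟨t^k a_s t^{-k} : s ∈ T, k ∈ ℤ⟩` -/

/-- The set of conjugates `t^k (a s) t^{-k}`, `s ∈ T`, `k ∈ ℤ`. [cite: MilnorSolvableGrowth1968, p. 448 (α_k)] -/
def conjSet (T : Finset Γ) (t : Γ) (a : Γ → Γ) : Set Γ := {g | ∃ s ∈ T, ∃ k : ℤ, g = t ^ k * a s * (t ^ k)⁻¹}

/-- `conjSet` is stable under conjugation by powers of `t`. [cite: MilnorSolvableGrowth1968, p. 448] -/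
theorem zpow_conj_mem_conjSet {T : Finset Γ} {t : Γ} {a : Γ → Γ} (j : ℤ) {x : Γ} (hx : x ∈ conjSet T t a) :
    t ^ j * x * (t ^ j)⁻¹ ∈ conjSet T t a := by
  obtain ⟨s, hs, k, rfl⟩ := hx
  refine ⟨s, hs, j + k, ?_⟩
  rw [zpow_add]
  group

/-- The span of `conjSet` is stable under conjugation by powers of `t`. [cite: MilnorSolvableGrowth1968, p. 448] -/
theorem zpow_conj_mem_closure_conjSet {T : Finset Γ} {t : Γ} {a : Γ → Γ} (j : ℤ) {x : Γ}
    (hx : x ∈ Subgroup.closure (conjSet T t a)) : t ^ j * x * (t ^ j)⁻¹ ∈ Subgroup.closure (conjSet T t a) :=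
  conj_mem_of_closure (fun _ hy => Subgroup.subset_closure (zpow_conj_mem_conjSet j hy)) hx

/-- **Decomposition `g = b · t^k`**: every `g ∈ ⟨T⟩` is `b t^k` with `b` in the span of the conjugates, provided each `s ∈ T` is `a_s t^{k_s}`.
[cite: MilnorSolvableGrowth1968, p. 449 (proof of Lemma 3: products γ_1^{i_1} ⋯ with a remainder in A)] -/
theorem exists_decomp {T : Finset Γ} {t : Γ} {a : Γ → Γ} (hs : ∀ s ∈ T, ∃ k : ℤ, s = a s * t ^ k) {g : Γ}
    (hg : g ∈ Subgroup.closure (T : Set Γ)) : ∃ b ∈ Subgroup.closure (conjSet T t a), ∃ k : ℤ, g = b * t ^ k := by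
  induction hg using Subgroup.closure_induction with
  | mem s hsT =>
    obtain ⟨k, hk⟩ := hs s (Finset.mem_coe.1 hsT)
    exact ⟨a s, Subgroup.subset_closure ⟨s, Finset.mem_coe.1 hsT, 0, by simp⟩, k, hk⟩
  | one => exact ⟨1, one_mem _, 0, by simp⟩
  | mul x y _ _ hx hy =>
    obtain ⟨b₁, hb₁, k₁, rfl⟩ := hx
    obtain ⟨b₂, hb₂, k₂, rfl⟩ := hy
    refine ⟨b₁ * (t ^ k₁ * b₂ * (t ^ k₁)⁻¹), mul_mem hb₁ (zpow_conj_mem_closure_conjSet k₁ hb₂), k₁ + k₂, ?_⟩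
    rw [zpow_add]
    group
  | inv x _ hx =>
    obtain ⟨b, hb, k, rfl⟩ := hx
    refine ⟨t ^ (-k) * b⁻¹ * (t ^ (-k))⁻¹, zpow_conj_mem_closure_conjSet (-k) (inv_mem hb), -k, ?_⟩
    rw [zpow_neg]
    group

/-- **`⟨T⟩ ∩ ker ψ` is the span of the conjugates** `t^k a_s t^{-k}` when `t ∈ ⟨T⟩`, `a_s ∈ ker ψ`, `s = a_s t^{k_s}` and no non-trivial power
of `t` lies in `ker ψ`. [cite: MilnorSolvableGrowth1968, Lemma 1 and p. 449] [cite: Rosset1976, Thm. 1 (proof)] -/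
theorem closure_inf_ker_eq {M : Type*} [Group M] (ψ : Γ →* M) (T : Finset Γ) (t : Γ) (a : Γ → Γ)
    (ht : t ∈ Subgroup.closure (T : Set Γ)) (ha : ∀ s ∈ T, a s ∈ ψ.ker) (hs : ∀ s ∈ T, ∃ k : ℤ, s = a s * t ^ k)
    (hinj : ∀ k : ℤ, t ^ k ∈ ψ.ker → k = 0) :
    Subgroup.closure (T : Set Γ) ⊓ ψ.ker = Subgroup.closure (conjSet T t a) := by
  refine le_antisymm ?_ ((Subgroup.closure_le _).2 ?_)
  · rintro g ⟨hgT, hgK⟩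
    obtain ⟨b, hb, k, rfl⟩ := exists_decomp hs hgT
    have hbK : b ∈ ψ.ker := by
      refine (Subgroup.closure_le ψ.ker).2 ?_ hb
      rintro _ ⟨s, hsT, j, rfl⟩
      exact (inferInstance : ψ.ker.Normal).conj_mem _ (ha s hsT) (t ^ j)
    have hk : t ^ k ∈ ψ.ker := by
      have := mul_mem (inv_mem hbK) hgK
      rwa [inv_mul_cancel_left] at this
    rw [hinj k hk, zpow_zero, mul_one]
    exact hb
  · rintro _ ⟨s, hsT, j, rfl⟩
    refine Subgroup.mem_inf.2 ⟨?_, ?_⟩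
    · have has : a s ∈ Subgroup.closure (T : Set Γ) := by
        obtain ⟨k, hk⟩ := hs s hsT
        have e : a s = s * (t ^ k)⁻¹ := eq_mul_inv_iff_mul_eq.2 hk.symm
        rw [e]
        exact mul_mem (Subgroup.subset_closure (Finset.mem_coe.2 hsT)) (inv_mem (zpow_mem ht k))
      exact mul_mem (mul_mem (zpow_mem ht j) has) (inv_mem (zpow_mem ht j))
    · exact (inferInstance : ψ.ker.Normal).conj_mem _ (ha s hsT) (t ^ j)

/-! ## §2 A generator of `ψ(⟨T⟩) ≤ ℤ` -/

/-- The image of `⟨T⟩` under an additive character `f`, as an additive subgroup of `ℤ`. [folklore] -/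
def imageSub (f : Γ →* Multiplicative ℤ) (T : Finset Γ) : AddSubgroup ℤ where
  carrier := {z | ∃ g ∈ Subgroup.closure (T : Set Γ), Multiplicative.toAdd (f g) = z}
  zero_mem' := ⟨1, one_mem _, by simp⟩
  add_mem' := by
    rintro _ _ ⟨g, hg, rfl⟩ ⟨h, hh, rfl⟩
    exact ⟨g * h, mul_mem hg hh, by rw [map_mul, toAdd_mul]⟩
  neg_mem' := by
    rintro _ ⟨g, hg, rfl⟩
    exact ⟨g⁻¹, inv_mem hg, by rw [map_inv, toAdd_inv]⟩

/-- **A generator of the image is attained on `⟨T⟩`**: some `t ∈ ⟨T⟩` has `f(g) ∈ ℤ·f(t)` for all `g ∈ ⟨T⟩` (subgroups of `ℤ` are cyclic).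
[folklore] -/
theorem exists_generator (f : Γ →* Multiplicative ℤ) (T : Finset Γ) : ∃ t ∈ Subgroup.closure (T : Set Γ),
    ∀ g ∈ Subgroup.closure (T : Set Γ), ∃ k : ℤ, Multiplicative.toAdd (f g) = k * Multiplicative.toAdd (f t) := by
  obtain ⟨d, hd⟩ := Int.subgroup_cyclic (imageSub f T)
  have hdmem : d ∈ imageSub f T := by
    rw [hd]
    exact AddSubgroup.subset_closure (Set.mem_singleton d)
  obtain ⟨t, ht, hft⟩ := hdmem
  refine ⟨t, ht, fun g hg => ?_⟩
  have hgmem : Multiplicative.toAdd (f g) ∈ imageSub f T := ⟨g, hg, rfl⟩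
  rw [hd, AddSubgroup.mem_closure_singleton] at hgmem
  obtain ⟨k, hk⟩ := hgmem
  exact ⟨k, by rw [hft, ← hk, smul_eq_mul]⟩

/-! ## §3 Milnor's kernel lemma -/

/-- **MILNOR'S KERNEL LEMMA (relative form)**: if `Γ = ⟨S⟩` and `Cay(Γ; S)` does not have exponential growth, then for every finitely generated
`H = ⟨T⟩ ≤ Γ` and every homomorphism `ψ : Γ → ℤ`, the subgroup `H ∩ ker ψ` is finitely generated.
[cite: MilnorSolvableGrowth1968, Lemma 1 pp. 447–448] [cite: Rosset1976, Thm. 1] -/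
theorem exists_finset_closure_inf_ker (S : Finset Γ) (hS : Subgroup.closure (S : Set Γ) = ⊤)
    (hG : ¬ HasExponentialGrowth (mulCayley (S : Set Γ))) (T : Finset Γ) (ψ : Γ →* Multiplicative ℤ) :
    ∃ T' : Finset Γ, Subgroup.closure (T' : Set Γ) = Subgroup.closure (T : Set Γ) ⊓ ψ.ker := by
  obtain ⟨t, ht, hgen⟩ := exists_generator ψ T
  set d : ℤ := Multiplicative.toAdd (ψ t) with hd_def
  by_cases hd : d = 0
  · -- the character vanishes on `H`: `H ∩ ker ψ = H`
    refine ⟨T, (inf_eq_left.2 ((Subgroup.closure_le _).2 fun s hs => ?_)).symm⟩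
    obtain ⟨k, hk⟩ := hgen s (Subgroup.subset_closure hs)
    rw [SetLike.mem_coe, MonoidHom.mem_ker, ← ofAdd_toAdd (ψ s), hk, hd, mul_zero, ofAdd_zero]
  · -- exponents `k_s` with `ψ(s) = k_s d`, kernel parts `a_s = s t^{-k_s}`
    choose! kf hkf using hgen
    set a : Γ → Γ := fun s => s * (t ^ kf s)⁻¹ with ha_def
    have haK : ∀ s ∈ T, a s ∈ ψ.ker := by
      intro s hs
      have hk := hkf s (Subgroup.subset_closure (Finset.mem_coe.2 hs))
      rw [MonoidHom.mem_ker, ← ofAdd_toAdd (ψ (a s)), ha_def]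
      simp only [map_mul, map_inv, map_zpow, toAdd_mul, toAdd_inv, toAdd_zpow, hk, ← hd_def, smul_eq_mul]
      rw [add_neg_cancel, ofAdd_zero]
    have hs : ∀ s ∈ T, ∃ k : ℤ, s = a s * t ^ k := fun s _ => ⟨kf s, by rw [ha_def]; group⟩
    have hinj : ∀ k : ℤ, t ^ k ∈ ψ.ker → k = 0 := by
      intro k hk
      rw [MonoidHom.mem_ker, map_zpow] at hk
      have h' : k * d = 0 := by
        have := congrArg Multiplicative.toAdd hk
        rwa [toAdd_zpow, toAdd_one, smul_eq_mul] at this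
      rcases mul_eq_zero.1 h' with h | h
      · exact h
      · exact absurd h hd
    have heq := closure_inf_ker_eq ψ T t a ht haK hs hinj
    -- finitely many conjugates per generator
    have hF : ∀ s : Γ, ∃ F : Finset Γ, (∀ f ∈ F, ∃ k : ℤ, f = t ^ k * a s * (t ^ k)⁻¹) ∧
        ∀ k : ℤ, t ^ k * a s * (t ^ k)⁻¹ ∈ Subgroup.closure (F : Set Γ) := fun s => exists_finset_conj S hS hG t (a s)
    choose F hF₁ hF₂ using hF
    refine ⟨T.biUnion F, ?_⟩
    rw [heq]
    refine le_antisymm ((Subgroup.closure_le _).2 fun f hf => ?_) ((Subgroup.closure_le _).2 ?_)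
    · obtain ⟨s, hsT, hfs⟩ := Finset.mem_biUnion.1 (Finset.mem_coe.1 hf)
      obtain ⟨k, rfl⟩ := hF₁ s f hfs
      exact Subgroup.subset_closure ⟨s, hsT, k, rfl⟩
    · rintro _ ⟨s, hsT, k, rfl⟩
      exact Subgroup.closure_mono (by
        intro x hx
        exact Finset.mem_coe.2 (Finset.mem_biUnion.2 ⟨s, hsT, Finset.mem_coe.1 hx⟩)) (hF₂ s k)

/-- The `i`-th coordinate character of `ℤ²`. [folklore] -/
def coordHom (i : Fin 2) : Multiplicative (Site 2) →* Multiplicative ℤ :=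
  AddMonoidHom.toMultiplicative (Pi.evalAddMonoidHom (fun _ : Fin 2 => ℤ) i)

/-- `coordHom i (ofAdd v) = ofAdd (v i)`. [folklore] -/
@[simp] theorem toAdd_coordHom (i : Fin 2) (v : Multiplicative (Site 2)) :
    Multiplicative.toAdd (coordHom i v) = Multiplicative.toAdd v i := rfl

/-- The kernel of `φ : Γ → ℤ²` is the intersection of the kernels of its two coordinates. [folklore] -/
theorem ker_eq_inf (φ : Γ →* Multiplicative (Site 2)) :
    φ.ker = ((coordHom 0).comp φ).ker ⊓ ((coordHom 1).comp φ).ker := by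
  ext g
  simp only [Subgroup.mem_inf, MonoidHom.mem_ker, MonoidHom.comp_apply]
  constructor
  · intro h
    simp [h, coordHom]
  · rintro ⟨h0, h1⟩
    have h0' : Multiplicative.toAdd (φ g) 0 = 0 := by
      have := congrArg Multiplicative.toAdd h0; rwa [toAdd_coordHom, toAdd_one] at this
    have h1' : Multiplicative.toAdd (φ g) 1 = 0 := by
      have := congrArg Multiplicative.toAdd h1; rwa [toAdd_coordHom, toAdd_one] at this
    rw [← ofAdd_toAdd (φ g), ← ofAdd_zero]
    congr 1
    funext i
    fin_cases i
    · exact h0'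
    · exact h1'

/-- **MILNOR'S KERNEL LEMMA for `ℤ²`**: if `Γ = ⟨S⟩` and `Cay(Γ; S)` does not have exponential growth, then the kernel of EVERY homomorphism
`Γ → ℤ²` is finitely generated (the relative form applied to `⊤ ∩ ker φ₀`, then to `ker φ₀ ∩ ker φ₁`).
[cite: MilnorSolvableGrowth1968, Lemma 1 pp. 447–448] [cite: Rosset1976, Thm. 1] -/
theorem ker_fg_of_not_hasExponentialGrowth (S : Finset Γ) (hS : Subgroup.closure (S : Set Γ) = ⊤)
    (hG : ¬ HasExponentialGrowth (mulCayley (S : Set Γ))) (φ : Γ →* Multiplicative (Site 2)) : φ.ker.FG := by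
  obtain ⟨T₁, hT₁⟩ := exists_finset_closure_inf_ker S hS hG S ((coordHom 0).comp φ)
  rw [hS, top_inf_eq] at hT₁
  obtain ⟨T₂, hT₂⟩ := exists_finset_closure_inf_ker S hS hG T₁ ((coordHom 1).comp φ)
  rw [hT₁, ← ker_eq_inf] at hT₂
  exact ⟨T₂, hT₂⟩

end Milnor

/-! ## §4 The payoff: INPUT(Cay(Γ; S)) = a homomorphism to `ℤ²` of rank-2 image, nothing else (modulo the scaled node) -/

namespace CayleyScaled

variable {Γ : Type} [Group Γ]

/-- `Cay(Γ; S)` is connected when `S` generates. [cite: BenjaminiSchramm1996, §2 (Cayley graphs)] -/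
theorem connected_mulCayley_of_closure (S : Finset Γ) (hS : Subgroup.closure (S : Set Γ) = ⊤) :
    (mulCayley (S : Set Γ)).Connected := by
  refine (connected_iff _).2 ⟨fun a b => ?_, ⟨1⟩⟩
  obtain ⟨m, ⟨wa, -⟩⟩ := Milnor.exists_mem_graphBall S hS a
  obtain ⟨n, ⟨wb, -⟩⟩ := Milnor.exists_mem_graphBall S hS b
  exact ⟨wa.reverse.append wb⟩

/-- `Cay(Γ; S)` is (quasi-)transitive: left translations move every vertex to `1`. [cite: BenjaminiSchramm1996, §2 (Cayley graphs)] -/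
theorem isQuasiTransitive_mulCayley (S : Finset Γ) : IsQuasiTransitive (mulCayley (S : Set Γ)) :=
  ⟨{1}, fun v => ⟨leftMulIso S v⁻¹, by rw [leftMulIso_apply, inv_mul_cancel]; exact Finset.mem_singleton_self 1⟩⟩

/-- **THEOREM (modulo the scaled node ALONE): every finitely generated group with a homomorphism to `ℤ²` of rank-2 image — equivalently
`b₁(Γ) ≥ 2` — EVERY finite generating set `S`: `θ_g(p_c(Cay(Γ; S))) = 0` at every vertex.**  ON exponential growth by Hutchcroft's theorem;
OFF exponential growth the kernel is finitely generated by Milnor's lemma and `criticalContinuity_of_kerFG` applies.  No kernel hypothesis.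
[cite: BenjaminiSchramm1996, Conj. 4; §2] [cite: Hutchcroft2016, Thm. 1.1] [cite: MilnorSolvableGrowth1968, Lemma 1] -/
theorem criticalContinuity_of_rank (hN : SamePDropOfSkeletonFrmScaled₁) (φ : Γ →* Multiplicative (Site 2))
    (hrank : ∃ a b : Γ, MaxArea.det2 (Multiplicative.toAdd (φ a)) (Multiplicative.toAdd (φ b)) ≠ 0)
    (S : Finset Γ) (hS : Subgroup.closure (S : Set Γ) = ⊤) (g : Γ) :
    theta (mulCayley (↑S : Set Γ)) g (criticalProbIOf (mulCayley (↑S : Set Γ)) g) = 0 := by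
  by_cases hG : HasExponentialGrowth (mulCayley (S : Set Γ))
  · exact Hutchcroft2016_noPercolationAtCriticality_holds _ (connected_mulCayley_of_closure S hS) (isQuasiTransitive_mulCayley S) hG g
  · exact criticalContinuity_of_kerFG hN φ hrank (Milnor.ker_fg_of_not_hasExponentialGrowth S hS hG φ) S hS g

/-- … and `θ_g(p) = 0` for every `p ≤ p_c`. [cite: BenjaminiSchramm1996, Conj. 4; §2] -/
theorem theta_eq_zero_of_le_of_rank (hN : SamePDropOfSkeletonFrmScaled₁) (φ : Γ →* Multiplicative (Site 2))
    (hrank : ∃ a b : Γ, MaxArea.det2 (Multiplicative.toAdd (φ a)) (Multiplicative.toAdd (φ b)) ≠ 0)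
    (S : Finset Γ) (hS : Subgroup.closure (S : Set Γ) = ⊤) (g : Γ) {p : unitInterval}
    (hp : (p : ℝ) ≤ criticalProb (mulCayley (↑S : Set Γ)) g) : theta (mulCayley (↑S : Set Γ)) g p = 0 := by
  haveI : Countable Γ := countable_of_connected_of_locallyFinite _ (connected_mulCayley_of_closure S hS) g
  rcases hp.lt_or_eq with hlt | heq
  · exact theta_eq_zero_of_lt_criticalProb_holds _ g p hlt
  · have e : p = criticalProbIOf (mulCayley (↑S : Set Γ)) g := Subtype.ext heq
    rw [e]
    exact criticalContinuity_of_rank hN φ hrank S hS g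

/-- **THEOREM (modulo the scaled node ALONE): every finitely generated group mapping ONTO `ℤ²`, every finite generating set: `θ_g(p_c) = 0`.**
[cite: BenjaminiSchramm1996, Conj. 4; §2] [cite: Hutchcroft2016, Thm. 1.1] [cite: MilnorSolvableGrowth1968, Lemma 1] -/
theorem criticalContinuity_of_surjective' (hN : SamePDropOfSkeletonFrmScaled₁) (φ : Γ →* Multiplicative (Site 2))
    (hφ : Function.Surjective φ) (S : Finset Γ) (hS : Subgroup.closure (S : Set Γ) = ⊤) (g : Γ) :
    theta (mulCayley (↑S : Set Γ)) g (criticalProbIOf (mulCayley (↑S : Set Γ)) g) = 0 :=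
  criticalContinuity_of_rank hN φ (rank_of_surjective φ hφ) S hS g

/-! ## §5 Products `X □ Cay(Γ; S)` for vertex-transitive `X`: the rank-2 homomorphism alone -/

/-- **THEOREM (modulo the scaled node ALONE): `X □ Cay(Γ; S)`** for every finitely generated `Γ` with a homomorphism to `ℤ²` of rank-2 image,
EVERY finite generating `S`, every connected locally finite vertex-transitive `X`: `θ_v(p_c) = 0` at every vertex.  ON exponential growth of
`Cay(Γ; S)` the product grows exponentially (`hasExponentialGrowth_boxProd_left`, factors commuted by `boxProdComm`) and Hutchcroft applies;
OFF it, Milnor's lemma feeds gen 16's `CayleyScaled.boxProd_criticalContinuity`.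
[cite: BenjaminiSchramm1996, Conj. 4; §2] [cite: Hutchcroft2016, Thm. 1.1] [cite: MilnorSolvableGrowth1968, Lemma 1] -/
theorem boxProd_criticalContinuity_of_rank {W : Type} (hN : SamePDropOfSkeletonFrmScaled₁) (φ : Γ →* Multiplicative (Site 2))
    (hrank : ∃ a b : Γ, MaxArea.det2 (Multiplicative.toAdd (φ a)) (Multiplicative.toAdd (φ b)) ≠ 0)
    (S : Finset Γ) (hS : Subgroup.closure (S : Set Γ) = ⊤) (X : SimpleGraph W) [X.LocallyFinite] (x₀ : W)
    (htr : ∀ x : W, ∃ γ : X ≃g X, γ x₀ = x) (hc : X.Connected) (v : W × Γ) :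
    theta (X □ mulCayley (↑S : Set Γ)) v (criticalProbIOf (X □ mulCayley (↑S : Set Γ)) v) = 0 := by
  by_cases hG : HasExponentialGrowth (mulCayley (S : Set Γ))
  · haveI : Countable Γ := countable_of_connected_of_locallyFinite _ (connected_mulCayley_of_closure S hS) 1
    haveI : Countable W := countable_of_connected_of_locallyFinite X hc x₀
    have hX : IsQuasiTransitive X := ⟨{x₀}, fun x => by
      obtain ⟨γ, hγ⟩ := htr x
      exact ⟨γ.symm, by rw [← hγ, RelIso.symm_apply_apply]; exact Finset.mem_singleton_self _⟩⟩
    have hpc : criticalProbIOf (SimpleGraph.boxProd X (mulCayley (↑S : Set Γ))) v =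
        criticalProbIOf (SimpleGraph.boxProd (mulCayley (↑S : Set Γ)) X) (SimpleGraph.boxProdComm X (mulCayley (↑S : Set Γ)) v) :=
      Subtype.ext (criticalProb_iso (SimpleGraph.boxProdComm X (mulCayley (↑S : Set Γ))) v).symm
    rw [hpc, ← theta_iso (SimpleGraph.boxProdComm X (mulCayley (↑S : Set Γ))) v]
    exact Hutchcroft2016_noPercolationAtCriticality_holds _ ((connected_mulCayley_of_closure S hS).boxProd hc)
      (isQuasiTransitive_boxProd (isQuasiTransitive_mulCayley S) hX) (hasExponentialGrowth_boxProd_left X hG) _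
  · exact (ofKerFG φ hrank (Milnor.ker_fg_of_not_hasExponentialGrowth S hS hG φ) S hS).boxProd_criticalContinuity hN X x₀ htr hc v

/-! ## §6 Example row: `K × ℤ²` for an ARBITRARY group `K` (any growth, any generating set of the product) -/

/-- **THEOREM (modulo the scaled node ALONE): every Cayley graph of `K × ℤ²`, for EVERY group `K` and every finite generating set of the
product, has `θ_g(p_c) = 0`** — the projection to `ℤ²` is a surjective homomorphism; nothing about `K` is used (if `K × ℤ²` is finitely generated
and of subexponential growth, Milnor makes `K` finitely generated; otherwise Hutchcroft applies).  Instances: `K` a torsion group of intermediate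
growth (Grigorchuk-type), `K` finite, `K` free. [cite: BenjaminiSchramm1996, Conj. 4; §2] [cite: MilnorSolvableGrowth1968, Lemma 1] -/
theorem criticalContinuity_prod_zTwo (hN : SamePDropOfSkeletonFrmScaled₁) (K : Type) [Group K]
    (S : Finset (K × Multiplicative (Site 2))) (hS : Subgroup.closure (S : Set (K × Multiplicative (Site 2))) = ⊤)
    (g : K × Multiplicative (Site 2)) :
    theta (mulCayley (↑S : Set (K × Multiplicative (Site 2)))) g (criticalProbIOf (mulCayley (↑S : Set (K × Multiplicative (Site 2)))) g) = 0 :=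
  criticalContinuity_of_surjective' hN (MonoidHom.snd K (Multiplicative (Site 2))) (fun x => ⟨(1, x), rfl⟩) S hS g

/-! ## §7 Entry point from two independent characters `Γ → ℤ` (`b₁(Γ) ≥ 2` as it is usually checked) -/

/-- Pairing two characters `ψ₀, ψ₁ : Γ → ℤ` into a homomorphism `Γ → ℤ²`. [folklore] -/
def pairHom (ψ₀ ψ₁ : Γ →* Multiplicative ℤ) : Γ →* Multiplicative (Site 2) where
  toFun g := Multiplicative.ofAdd ![Multiplicative.toAdd (ψ₀ g), Multiplicative.toAdd (ψ₁ g)]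
  map_one' := by
    rw [ψ₀.map_one, ψ₁.map_one, toAdd_one, ← ofAdd_zero]
    congr 1
    funext i
    fin_cases i <;> rfl
  map_mul' g h := by
    rw [← ofAdd_add, ψ₀.map_mul, ψ₁.map_mul, toAdd_mul, toAdd_mul]
    congr 1
    funext i
    fin_cases i <;> rfl

/-- The coordinates of `pairHom`. [folklore] -/
@[simp] theorem toAdd_pairHom_zero (ψ₀ ψ₁ : Γ →* Multiplicative ℤ) (g : Γ) :
    Multiplicative.toAdd (pairHom ψ₀ ψ₁ g) 0 = Multiplicative.toAdd (ψ₀ g) := rfl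

/-- The coordinates of `pairHom`. [folklore] -/
@[simp] theorem toAdd_pairHom_one (ψ₀ ψ₁ : Γ →* Multiplicative ℤ) (g : Γ) :
    Multiplicative.toAdd (pairHom ψ₀ ψ₁ g) 1 = Multiplicative.toAdd (ψ₁ g) := rfl

/-- **THEOREM (modulo the scaled node ALONE), two-character form**: if `Γ` has two homomorphisms `ψ₀, ψ₁ : Γ → ℤ` that are independent on some pair
`a, b` (`ψ₀(a)ψ₁(b) ≠ ψ₁(a)ψ₀(b)` — i.e. `b₁(Γ) ≥ 2`), then EVERY Cayley graph of `Γ` has `θ_g(p_c) = 0`.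
[cite: BenjaminiSchramm1996, Conj. 4; §2] [cite: MilnorSolvableGrowth1968, Lemma 1] -/
theorem criticalContinuity_of_two_characters (hN : SamePDropOfSkeletonFrmScaled₁) (ψ₀ ψ₁ : Γ →* Multiplicative ℤ) (a b : Γ)
    (hind : Multiplicative.toAdd (ψ₀ a) * Multiplicative.toAdd (ψ₁ b) ≠ Multiplicative.toAdd (ψ₁ a) * Multiplicative.toAdd (ψ₀ b))
    (S : Finset Γ) (hS : Subgroup.closure (S : Set Γ) = ⊤) (g : Γ) :
    theta (mulCayley (↑S : Set Γ)) g (criticalProbIOf (mulCayley (↑S : Set Γ)) g) = 0 :=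
  criticalContinuity_of_rank hN (pairHom ψ₀ ψ₁)
    ⟨a, b, by rw [MaxArea.det2, toAdd_pairHom_zero, toAdd_pairHom_one, toAdd_pairHom_zero, toAdd_pairHom_one]; exact sub_ne_zero.2 hind⟩ S hS g

end CayleyScaled

end Summit.CriticalPhenomena.PercolationContinuityZ3.Theorems.Transplant

end
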